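import Literature.MathematicalPhysics.QuantumFieldTheory.Balaban1983to89.B9BackgroundsKLevelV1
import Literature.MathematicalPhysics.QuantumFieldTheory.Balaban1983to89.B7Prop2SpecialUnitary
import Literature.MathematicalPhysics.QuantumFieldTheory.Balaban1983to89.T3PrintedRegularMinimiser
import Summits.QuantumFields.YangMills.Theorems.UnitScaleTiltProp7SectET3Members
import HarnessLib

/-!
# Route `UnitScaleTilt`, crux «MinimiserStabilityRegPr» (stmt-QuantumFields-19200, v10 stub EX `stub_existenceMinimalOrbit`, route (α)) — OWNER RULING g25-№1∕№2,
# item (S2-bg): **THE BACKGROUND-CLASS READING OF THE N06(d = 3) LEAVES AT THE T³ MEMBERS — the `bg` slot of `B9.Thm313Printed` ∕ `Thm312Printed` — AND THE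
# CLASS-TRANSFER ROW «𝔘_k(L³B₃ε₁) ⊂ (3.35) ∧ (3.36)» AS ONE DISPLAYED SCHEMA (a LOCATED sub-node of EX: [Balaban1985RegularSpaces] Prop. 6, flat depth)**

Cell `ym3-torus` (HUMAN RULING D-0037, YM ladder rung R3 — NOT the Clay problem), width seat ym-ust-20520-w1 g2, re-pointed 2026-08-28T01:58:34Z.  Count-neutral helper
(`--supports … --as helper`); registry untouched; nothing of [Balaban1985RegularSpaces]∕[Balaban1985BackgroundPropagators] is asserted.

WHAT THE N06 LEAVES READ.  `B9.Thm313Printed c35 geo bg GG …` ∕ `B9.Thm312Printed …` quantify `∀ i, … ∀ U : (bg i).Cfg, (bg i).Reg335 c35 α₀ U → (bg i).Reg336 c35 α₀ U → …`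
([Balaban1985BackgroundPropagators] (3.35)–(3.36) p.396).  At the T³ members of R3 (★w3-20520 g2's index of record: def-Y's k-level index `i : KIdx 2 ℓ hd hL b₀ b₁`, geometry
`geo9K i`, p595877; member map (S2-idx)) the background carrier is def-Y's `B9BackgroundsKLevelV1.bg9K 𝔸 G i` — classes WITH BODIES on the V1 torus `Site (PV 2 ℓ i.m i.K) 0` — at
`𝔸 := M₂(ℂ)`, `G := SU(2)ˣ` (`B7Prop2SpecialUnitary.specialUnitaryUnits (Fin 2)`), and the route's `SU(2)` field `U₀ : GaugeField (F.P K) 0 SU(2)` (`F = ⟨ℓ+1, hL, m, hm⟩`,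
`F.P K = PV 2 ℓ m K` by `rfl` — ★p1's port convention `UnitScaleTiltProp8FlatPortChart`) is read bondwise through `unitsField ∘ toUField` (the letters of `T3PrintedRegularMinimiser.DivSmall`
and of ★w2-19200 g2's (115)-objects):
* §1 **`bgT3 i`** (:= `bg9K M₂(ℂ) SU(2)ˣ i`), **`cfgV1OfT3 U₀`** (:= `fun μ x => unitsField (toUField U₀) ⟨x, μ⟩`), `val_cfgV1OfT3`, **`cfgV1OfT3_mem`** (the «U has values in G»
  conjunct of `Reg335Body` holds for EVERY SU(2) field), the junction **`cfgV1OfT3_eq_of_equiv`** with ★w2-19200 g2's lambda `fun b => unitsField (toUField U₀) ⟨e.symm b.1, b.2⟩`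
  against an ABSTRACT site equivalence `e` (discharged by ★w5-20520's `Prop7SectET3Transport.siteEquiv` by `exact`), `cfgV1OfT3_one` (the trivial field reads as `(bgT3 i).one`),
  and the unfoldings **`reg335_bgT3_iff`** ∕ **`reg336_bgT3_iff`**: `(bgT3 i).Reg335 c α₀ (cfgV1OfT3 U₀) ↔ B9Eq335RegularityClasses.Reg335 (shiftsV1 _) (cfgV1OfT3 U₀) (kGeo i).eta (ℓ+1)
  (cubeClass396 i) (c·(kGeo i).M·α₀)` (the SU(2)-clause discharged) — r06's (3.35): on every cube `□` of the class, of index `j`, `∃ u A`, `‖u‖, ‖u⁻¹‖ ≤ 1` on `□`, `U^u = e^{iηA}` on `□`,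
  `‖A‖ < C·(Lʲη)⁻¹`, `‖η⁻¹D¹A‖ < C·(Lʲη)⁻²` (and `‖∂^{η*}∂^ηA‖ < C·(Lʲη)⁻³` for (3.36)); `(kGeo i).eta = |i.cf|⁻¹` (= `L^{−(K−n)}` once the member map pins `i.cf := L^{K−n}`),
  `(kGeo i).M = L·M_h`.
* §2 **`ClassTransferT3 ℓ hL c35 : Prop`** — THE CLASS-TRANSFER ROW (hypothesis schema, NEVER asserted) AT ★w3-20520 g2's member of record `Prop7SectET3Members.memberIdx` (p596287): for every member `(m, n, K, a', R)`, every
  `B₃, ε₁ > 0` and every `U₀` with `RegPr ⟨ℓ+1, hL, m, hm⟩ n K (L³B₃ε₁) U₀` ([Balaban1985Variational] (6)∕(14): plaquettes `< L³B₃ε₁·L^{−2(K−n)}`, covariant divergence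
  `< L³B₃ε₁·L^{−3(K−n)}`): `(bgT3 (memberIdx …)).Reg335 c35 (L³B₃ε₁) (cfgV1OfT3 U₀) ∧ (bgT3 (memberIdx …)).Reg336 c35 (L³B₃ε₁) (cfgV1OfT3 U₀)`.  THIS IS [Balaban1985RegularSpaces] (1.33) SECOND CLAUSE
  («we will see later that this condition is a consequence of the first one», p.82) = PROP. 6 p.99 ((1.135)–(1.136): on `□̃`, `U₀^{w⁻¹} = e^{iηA}` with `Lʲη|A|, (Lʲη)²|∇^ηA|,
  (Lʲη)³|∂^{η*}∂^ηA|, (Lʲη)³|Δ^ηA| < 7dL²B₁Mα₀`), proved in print from THEOREM 4 AT THE PAIR `(1, U₀″)` (flat background) — tree: `B8Prop6OfThm4.prop6_of_thm4` CONDITIONAL on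
  `Thm4AtOne` («never instantiated»), Track A's ℤᵈ kernel chain `B8Prop6CubeMember.prop6_asPrinted_cubeMember_of_HFP₄` (concrete Thm-4 driver at `U₀ := 1`, MODULO four FLAT
  sockets; `|A|`-member only, `∇/∂*∂/Δ` = Prop. 3 at the member).  NOT KINEMATIC: the tree's elementary criterion `B9Eq335AxialCriterion.reg335Zd_of_plaq_radii` (complete axial
  gauge) needs a transported plaquette-GRADIENT radius `c₀η³` that `𝔘_k` does not carry ((1.9) bounds the covariant DIVERGENCE) — in the pure-small-field member (every `Ω_j` the
  torus ⇒ `levV1 ≡ k`, only TOP-index cubes, `ξ = Lᵏη = 1`, `ℓ¹`-radius `≈ 30·M·Lᵏ` fine bonds) the plaquette clause alone gives `‖A‖ ≤ 60·M·α` ✓ but `‖η⁻¹D¹A‖ ≲ 60·M·α·Lᵏ` —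
  off by `Lᵏ = η⁻¹`.  So the row is a LOCATED SUB-NODE of EX of depth «[B8] Thm 4 ∕ Prop. 3 ∕ Prop. 5 at the FLAT background on a cube» (N05-at-background-1; sibling of COV's
  [B8] Thm 2 socket), NOT N06 (curved) depth and NOT W-sized.  `c35` is a parameter of the row AFTER `ℓ` (print's constant `7dL²B₁` is `L`-dependent; the cube size `M` is
  already factored: `C = c35·M·α₀`).
* §3 **`reg335_reg336_of_regPr_of_classTransfer`** (the OWNER's (ii) name, FROM the row — so (S3-b) has the binder by name today), `reg335_of_…` (unfolded to r06's class),
  the member's letters `eta_memberIdx` (`= (L^{K−n})⁻¹`) ∕ `M_memberIdx` (`= L·L^{a'}`), and NON-VACUITY at the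
  trivial field: **`reg335_reg336_cfgV1OfT3_one`** (`U₀ ≡ 1` is in both classes for every `c35, α₀ > 0` — def-Y's `reg336_one`; [Balaban1985RegularSpaces] p.98 «identically
  equal to 1 satisfies, of course, all possible regularity conditions»), and `regPr_one` recalled, so the row's hypothesis and conclusion are simultaneously inhabited.
HONEST SCOPE: letters + one displayed schema + bookkeeping; no estimate; the row is NOT proved (it is [B8] Prop. 6 at the T³ cube members); nothing here claims EX, the crux,
V3∕R3, d = 4 or the mass gap.

References: T. Bałaban, CMP **99** (1985) 75–102 [Balaban1985RegularSpaces] ((1.33) p.82, pp.98–99 (1.127), (1.132)–(1.138), Prop. 6 p.99, Thm 4 p.88); CMP **99** (1985)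
389–434 [Balaban1985BackgroundPropagators] ((3.35)–(3.38) p.396, Thm 3.12 p.423, Thm 3.13 p.426); CMP **102** (1985) 277–309 [Balaban1985Variational] ((2) p.278, (6) p.278,
(14) p.280); CMP **98** (1985) 17–51 [Balaban1985Averaging] (pp.24–25, the axial gauge).
-/

set_option autoImplicit false

noncomputable section

open scoped Matrix.Norms.L2Operator

namespace Summit.QuantumFields.YangMills.Theorems.Prop7SectET3BgClass

open Literature.MathematicalPhysics.QuantumFieldTheory.Balaban1983to89
open Literature.MathematicalPhysics.QuantumFieldTheory.Balaban1983to89.T3ContinuumYM3Torus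
open Literature.MathematicalPhysics.QuantumFieldTheory.Balaban1983to89.T3PrintedRegularMinimiser (RegPr regPr_one)
open Literature.MathematicalPhysics.QuantumFieldTheory.Balaban1983to89.B10Eq27TorusAxialLog (toUField unitsField val_unitsField)
open Literature.MathematicalPhysics.QuantumFieldTheory.Balaban1983to89.B6KLevelCensusIndexV1 (KIdx kGeo)
open Literature.MathematicalPhysics.QuantumFieldTheory.Balaban1983to89.B6GlobalChartV1 (PV)
open Literature.MathematicalPhysics.QuantumFieldTheory.Balaban1983to89.B9BackgroundsKLevelV1
  (bg9K CfgV1 shiftsV1 cubeClass396 reg335_iff reg336_iff reg335_one reg336_one reg336_reg335)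
open Literature.MathematicalPhysics.QuantumFieldTheory.Balaban1983to89.B7Prop2SpecialUnitary (specialUnitaryUnits mem_specialUnitaryUnits)
open Summit.QuantumFields.YangMills.Theorems.Prop7SectET3Members (hd3 memberIdx)

variable {ℓ : ℕ} {hL : Odd (ℓ + 1) ∧ 1 < ℓ + 1} {b₀ b₁ : ℝ}

/-! ## §1 The letters: the background carrier at a T³ member and the reading of the route's SU(2) field -/

/-- **THE BACKGROUND CARRIER OF THE N06(d = 3) LEAVES AT A T³ MEMBER** — the `bg i` slot of `B9.Thm313Printed` ∕ `B9.Thm312Printed`: def-Y's k-level carrier WITH BODIES at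
`𝔸 := M₂(ℂ)`, `G := SU(2)ˣ` (configurations `Fin 3 → Site (PV 2 ℓ i.m i.K) 0 → M₂(ℂ)ˣ`; classes (3.35)–(3.38) = `Reg335Body` &c. over the cube class `cubeClass396 i`, constant
`c·(L·M_h)·α₀`, scale `(kGeo i).eta`). [cite: Balaban1985BackgroundPropagators, (3.35)-(3.38) p.396] -/
abbrev bgT3 (i : KIdx 2 ℓ hd3 hL b₀ b₁) : B9.Backgrounds :=
  bg9K (Matrix (Fin 2) (Fin 2) ℂ) (specialUnitaryUnits (Fin 2)) i

/-- **THE ROUTE'S SU(2) FIELD READ AS A V1 BACKGROUND**: `U₀ ↦ (μ, x) ↦ U₀(x, x + e_μ)` in the units of `M₂(ℂ)` (`unitsField ∘ toUField`, the letters of `DivSmall` ∕ (115)).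
Stated for any lattice parameters `P` (at `P := F.P K = PV 2 ℓ F.m K` it lands in `(bgT3 i).Cfg`). [cite: Balaban1985BackgroundPropagators, Sect. A p.390 («U = {U(x, x′)} defined on bonds of T_η»)] -/
def cfgV1OfT3 {P : Params} (U₀ : GaugeField P 0 (Matrix.specialUnitaryGroup (Fin 2) ℂ)) : CfgV1 P (Matrix (Fin 2) (Fin 2) ℂ) :=
  fun μ x => unitsField (toUField U₀) ⟨x, μ⟩

/-- The reading, unfolded. [folklore] -/
@[simp] theorem cfgV1OfT3_apply {P : Params} (U₀ : GaugeField P 0 (Matrix.specialUnitaryGroup (Fin 2) ℂ)) (μ : Fin P.d) (x : Site P 0) :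
    cfgV1OfT3 U₀ μ x = unitsField (toUField U₀) ⟨x, μ⟩ := rfl

/-- Its bond variables are the same matrices. [folklore] -/
theorem val_cfgV1OfT3 {P : Params} (U₀ : GaugeField P 0 (Matrix.specialUnitaryGroup (Fin 2) ℂ)) (μ : Fin P.d) (x : Site P 0) :
    ((cfgV1OfT3 U₀ μ x : (Matrix (Fin 2) (Fin 2) ℂ)ˣ) : Matrix (Fin 2) (Fin 2) ℂ) = ((U₀ ⟨x, μ⟩ : Matrix.specialUnitaryGroup (Fin 2) ℂ) : Matrix (Fin 2) (Fin 2) ℂ) := by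
  rw [cfgV1OfT3_apply, val_unitsField]
  rfl

/-- **«U HAS VALUES IN G»** — the first conjunct of def-Y's `Reg335Body` ∕ `Reg336Body` — holds for the reading of EVERY SU(2) field. [cite: Balaban1985BackgroundPropagators, p.396 («where U has values in G»)] -/
theorem cfgV1OfT3_mem {P : Params} (U₀ : GaugeField P 0 (Matrix.specialUnitaryGroup (Fin 2) ℂ)) (μ : Fin P.d) (x : Site P 0) :
    cfgV1OfT3 U₀ μ x ∈ specialUnitaryUnits (Fin 2) := by
  rw [mem_specialUnitaryUnits, val_cfgV1OfT3]
  exact (U₀ ⟨x, μ⟩).2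

/-- **JUNCTION WITH ★w2-19200 g2's (115)-OBJECTS**: against ANY site equivalence `e : Site P 0 ≃ S` (★w5-20520's `Prop7SectET3Transport.siteEquiv F K`, `S = TSite 3 (periodsT3 F K)`),
the V1 reading at `x` IS their background lambda `fun b => unitsField (toUField U₀) ⟨e.symm b.1, b.2⟩` at the bond `(e x, μ)` — so both files speak of the SAME background.
[cite: Balaban1985BackgroundPropagators, Sect. A p.390 (bookkeeping)] -/
theorem cfgV1OfT3_eq_of_equiv {P : Params} {S : Type} (e : Site P 0 ≃ S) (U₀ : GaugeField P 0 (Matrix.specialUnitaryGroup (Fin 2) ℂ)) (μ : Fin P.d) (x : Site P 0) :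
    cfgV1OfT3 U₀ μ x = (fun b : S × Fin P.d => unitsField (toUField U₀) ⟨e.symm b.1, b.2⟩) (e x, μ) := by
  simp only [cfgV1OfT3_apply, Equiv.symm_apply_apply]

/-- … and conversely at a bond of the target carrier. [cite: Balaban1985BackgroundPropagators, Sect. A p.390 (bookkeeping)] -/
theorem lambda_eq_cfgV1OfT3_of_equiv {P : Params} {S : Type} (e : Site P 0 ≃ S) (U₀ : GaugeField P 0 (Matrix.specialUnitaryGroup (Fin 2) ℂ)) (b : S × Fin P.d) :
    unitsField (toUField U₀) ⟨e.symm b.1, b.2⟩ = cfgV1OfT3 U₀ b.2 (e.symm b.1) := rfl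

/-- **THE TRIVIAL FIELD READS AS THE CARRIER'S `one`.** [cite: Balaban1985RegularSpaces, p.98 («identically equal to 1»)] -/
theorem cfgV1OfT3_one (i : KIdx 2 ℓ hd3 hL b₀ b₁) :
    cfgV1OfT3 (1 : GaugeField (PV 2 ℓ i.m i.K hd3 hL) 0 (Matrix.specialUnitaryGroup (Fin 2) ℂ)) = (bgT3 i).one := by
  funext μ x
  show unitsField (toUField (1 : GaugeField (PV 2 ℓ i.m i.K hd3 hL) 0 (Matrix.specialUnitaryGroup (Fin 2) ℂ))) ⟨x, μ⟩ = 1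
  apply Units.ext
  rw [val_unitsField, Units.val_one]
  rfl

/-- **(3.35) AT THE MEMBER, UNFOLDED AT THE ROUTE'S FIELD** (the SU(2)-clause discharged): `(bgT3 i).Reg335 c α₀ (cfgV1OfT3 U₀) ↔` r06's class for the torus shifts, the member's
`η`, `L = ℓ+1`, cube class and constant `c·M·α₀`. [cite: Balaban1985BackgroundPropagators, (3.35) p.396] -/
theorem reg335_bgT3_iff (i : KIdx 2 ℓ hd3 hL b₀ b₁) (c α₀ : ℝ) (U₀ : GaugeField (PV 2 ℓ i.m i.K hd3 hL) 0 (Matrix.specialUnitaryGroup (Fin 2) ℂ)) :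
    (bgT3 i).Reg335 c α₀ (cfgV1OfT3 U₀) ↔
      B9Eq335RegularityClasses.Reg335 (shiftsV1 _) (cfgV1OfT3 U₀) (kGeo i).eta ((ℓ + 1 : ℕ) : ℝ) (cubeClass396 i) (c * (kGeo i).M * α₀) := by
  rw [reg335_iff]
  exact ⟨fun h => h.2, fun h => ⟨fun μ x => cfgV1OfT3_mem U₀ μ x, h⟩⟩

/-- **(3.35)–(3.36) AT THE MEMBER, UNFOLDED AT THE ROUTE'S FIELD.** [cite: Balaban1985BackgroundPropagators, (3.35)-(3.36) p.396] -/
theorem reg336_bgT3_iff (i : KIdx 2 ℓ hd3 hL b₀ b₁) (c α₀ : ℝ) (U₀ : GaugeField (PV 2 ℓ i.m i.K hd3 hL) 0 (Matrix.specialUnitaryGroup (Fin 2) ℂ)) :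
    (bgT3 i).Reg336 c α₀ (cfgV1OfT3 U₀) ↔
      B9Eq335RegularityClasses.Reg336 (shiftsV1 _) (cfgV1OfT3 U₀) (kGeo i).eta ((ℓ + 1 : ℕ) : ℝ) (cubeClass396 i) (c * (kGeo i).M * α₀) := by
  rw [reg336_iff]
  exact ⟨fun h => h.2, fun h => ⟨fun μ x => cfgV1OfT3_mem U₀ μ x, h⟩⟩

/-! ## §2 The class-transfer row at ★w3-20520 g2's member of record (displayed; a located sub-node of EX) -/

/-- **THE CLASS-TRANSFER ROW «𝔘_k(L³B₃ε₁) ⊂ (3.35) ∧ (3.36) ON THE T³ CUBE CLASS»** (hypothesis schema, NEVER asserted — [Balaban1985RegularSpaces] (1.33) second clause =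
Prop. 6 (1.135)–(1.136) at every T³ member, with `α₀ ↦ c35·L³B₃ε₁`), AT THE MEMBER OF RECORD `Prop7SectET3Members.memberIdx` (★w3-20520 g2, p596287: `F = ⟨ℓ+1, hL, m, hm⟩`,
height `K − n ≥ 1`, big blocks `L^{a'}`, collar `R`, padded chart, `c_f = L^{K−n}` so `(kGeo i).eta = L^{−(K−n)}`, pure-small-field family): for every such member, every
`B₃, ε₁ > 0` and every SU(2) field `U₀` in print's regular space `RegPr F n K (L³B₃ε₁)` ([Balaban1985Variational] (6)∕(14): plaquettes `< L³B₃ε₁·L^{−2(K−n)}`, covariant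
divergence `< L³B₃ε₁·L^{−3(K−n)}`), the V1 reading of `U₀` lies in def-Y's classes (3.35) and (3.36) of the member with threshold constant `c35`.  NOT kinematic (the axial
gauge misses the gradient clause by `η⁻¹`); print's road is Theorem 4 at the flat background on each cube (tree: `B8Prop6OfThm4.prop6_of_thm4`, conditional on `Thm4AtOne`).
[cite: Balaban1985RegularSpaces, (1.33) p.82, Prop. 6 (1.135)-(1.136) p.99; Balaban1985BackgroundPropagators, (3.35)-(3.36) p.396] -/
def ClassTransferT3 (ℓ : ℕ) (hL : Odd (ℓ + 1) ∧ 1 < ℓ + 1) (c35 : ℝ) : Prop :=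
  ∀ (hℓ : 4 ≤ ℓ) (m : ℕ) (hm : 1 ≤ m) (n K a' R : ℕ) (hk1 : 1 ≤ K - n) (hsize : a' + 3 ≤ m + n) (hM8 : 8 ≤ (ℓ + 1) ^ a')
    (hR2 : 2 * (ℓ + 1) ^ 2 ≤ R) (B₃ ε₁ : ℝ), 0 < B₃ → 0 < ε₁ →
      ∀ U₀ : GaugeField (PV 2 ℓ m K hd3 hL) 0 (Matrix.specialUnitaryGroup (Fin 2) ℂ),
        RegPr (⟨ℓ + 1, hL, m, hm⟩ : T3Family) n K (((ℓ + 1 : ℕ) : ℝ) ^ 3 * B₃ * ε₁) U₀ →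
          (bgT3 (memberIdx ℓ hL hℓ m hm n K a' R hk1 hsize hM8 hR2)).Reg335 c35 (((ℓ + 1 : ℕ) : ℝ) ^ 3 * B₃ * ε₁) (cfgV1OfT3 U₀) ∧
            (bgT3 (memberIdx ℓ hL hℓ m hm n K a' R hk1 hsize hM8 hR2)).Reg336 c35 (((ℓ + 1 : ℕ) : ℝ) ^ 3 * B₃ * ε₁) (cfgV1OfT3 U₀)

/-! ## §3 The OWNER's (ii) from the row, and non-vacuity -/

/-- **`reg335_reg336_of_regPr` FROM THE ROW** (the binder (S3-b) consumes by name): under `ClassTransferT3 ℓ hL c35`, every `U₀ ∈ 𝔘_k(L³B₃ε₁)` of the member `(F, n, K)`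
reads in (3.35) ∧ (3.36) of `memberIdx …` with constant `c35·(L·L^{a'})·L³B₃ε₁`. [cite: Balaban1985RegularSpaces, (1.33) p.82, Prop. 6 p.99; Balaban1985BackgroundPropagators, (3.35)-(3.36) p.396] -/
theorem reg335_reg336_of_regPr_of_classTransfer {c35 : ℝ} (hCT : ClassTransferT3 ℓ hL c35) (hℓ : 4 ≤ ℓ) (m : ℕ) (hm : 1 ≤ m) (n K a' R : ℕ)
    (hk1 : 1 ≤ K - n) (hsize : a' + 3 ≤ m + n) (hM8 : 8 ≤ (ℓ + 1) ^ a') (hR2 : 2 * (ℓ + 1) ^ 2 ≤ R) {B₃ ε₁ : ℝ} (hB₃ : 0 < B₃) (hε₁ : 0 < ε₁)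
    (U₀ : GaugeField (PV 2 ℓ m K hd3 hL) 0 (Matrix.specialUnitaryGroup (Fin 2) ℂ))
    (hreg : RegPr (⟨ℓ + 1, hL, m, hm⟩ : T3Family) n K (((ℓ + 1 : ℕ) : ℝ) ^ 3 * B₃ * ε₁) U₀) :
    (bgT3 (memberIdx ℓ hL hℓ m hm n K a' R hk1 hsize hM8 hR2)).Reg335 c35 (((ℓ + 1 : ℕ) : ℝ) ^ 3 * B₃ * ε₁) (cfgV1OfT3 U₀) ∧
      (bgT3 (memberIdx ℓ hL hℓ m hm n K a' R hk1 hsize hM8 hR2)).Reg336 c35 (((ℓ + 1 : ℕ) : ℝ) ^ 3 * B₃ * ε₁) (cfgV1OfT3 U₀) :=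
  hCT hℓ m hm n K a' R hk1 hsize hM8 hR2 B₃ ε₁ hB₃ hε₁ U₀ hreg

/-- The (3.35) half alone, unfolded to r06's class (what `Thm313Printed`'s first class binder reads): scale `(kGeo i).eta = |L^{K−n}|⁻¹`, `L = ℓ+1`, the member's cube class,
constant `c35·M·L³B₃ε₁`. [cite: Balaban1985BackgroundPropagators, (3.35) p.396] -/
theorem reg335_of_regPr_of_classTransfer {c35 : ℝ} (hCT : ClassTransferT3 ℓ hL c35) (hℓ : 4 ≤ ℓ) (m : ℕ) (hm : 1 ≤ m) (n K a' R : ℕ)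
    (hk1 : 1 ≤ K - n) (hsize : a' + 3 ≤ m + n) (hM8 : 8 ≤ (ℓ + 1) ^ a') (hR2 : 2 * (ℓ + 1) ^ 2 ≤ R) {B₃ ε₁ : ℝ} (hB₃ : 0 < B₃) (hε₁ : 0 < ε₁)
    (U₀ : GaugeField (PV 2 ℓ m K hd3 hL) 0 (Matrix.specialUnitaryGroup (Fin 2) ℂ))
    (hreg : RegPr (⟨ℓ + 1, hL, m, hm⟩ : T3Family) n K (((ℓ + 1 : ℕ) : ℝ) ^ 3 * B₃ * ε₁) U₀) :
    B9Eq335RegularityClasses.Reg335 (shiftsV1 (PV 2 ℓ m K hd3 hL)) (cfgV1OfT3 U₀) (kGeo (memberIdx ℓ hL hℓ m hm n K a' R hk1 hsize hM8 hR2)).eta ((ℓ + 1 : ℕ) : ℝ)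
      (cubeClass396 (memberIdx ℓ hL hℓ m hm n K a' R hk1 hsize hM8 hR2))
      (c35 * (kGeo (memberIdx ℓ hL hℓ m hm n K a' R hk1 hsize hM8 hR2)).M * (((ℓ + 1 : ℕ) : ℝ) ^ 3 * B₃ * ε₁)) :=
  (reg335_bgT3_iff (memberIdx ℓ hL hℓ m hm n K a' R hk1 hsize hM8 hR2) c35 (((ℓ + 1 : ℕ) : ℝ) ^ 3 * B₃ * ε₁) U₀).1
    (hCT hℓ m hm n K a' R hk1 hsize hM8 hR2 B₃ ε₁ hB₃ hε₁ U₀ hreg).1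

/-- The member's scale letter is the route's: `(kGeo (memberIdx …)).eta = (L^{K−n})⁻¹` (`c_f = L^{K−n} > 0`). [cite: Balaban1985BackgroundPropagators, Sect. A p.390 (the lattice spacing η)] -/
theorem eta_memberIdx (hℓ : 4 ≤ ℓ) (m : ℕ) (hm : 1 ≤ m) (n K a' R : ℕ) (hk1 : 1 ≤ K - n) (hsize : a' + 3 ≤ m + n) (hM8 : 8 ≤ (ℓ + 1) ^ a')
    (hR2 : 2 * (ℓ + 1) ^ 2 ≤ R) :
    (kGeo (memberIdx ℓ hL hℓ m hm n K a' R hk1 hsize hM8 hR2)).eta = ((((ℓ + 1 : ℕ) : ℝ)) ^ (K - n))⁻¹ := by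
  show |(((ℓ + 1 : ℕ) : ℝ)) ^ (K - n)|⁻¹ = _
  rw [abs_of_nonneg (by positivity)]

/-- The member's cube-size letter: `(kGeo (memberIdx …)).M = L·L^{a'}`. [cite: Balaban1985BackgroundPropagators, p.396 («O(1)M is a size of □»)] -/
theorem M_memberIdx (hℓ : 4 ≤ ℓ) (m : ℕ) (hm : 1 ≤ m) (n K a' R : ℕ) (hk1 : 1 ≤ K - n) (hsize : a' + 3 ≤ m + n) (hM8 : 8 ≤ (ℓ + 1) ^ a')
    (hR2 : 2 * (ℓ + 1) ^ 2 ≤ R) :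
    (kGeo (memberIdx ℓ hL hℓ m hm n K a' R hk1 hsize hM8 hR2)).M = ((ℓ + 1 : ℕ) : ℝ) * (((ℓ + 1) ^ a' : ℕ) : ℝ) := rfl

/-- **NON-VACUITY AT THE TRIVIAL FIELD**: `U₀ ≡ 1` reads in BOTH classes of every member for every `c35 > 0`, `α₀ > 0` (`u = 1`, `A = 0`; def-Y's `reg336_one`) — and `U₀ ≡ 1 ∈ 𝔘_k(α₀)`
(`regPr_one`), so the row's hypothesis and conclusion are inhabited together. [cite: Balaban1985RegularSpaces, p.98 («identically equal to 1 satisfies … all possible regularity conditions»)] -/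
theorem reg335_reg336_cfgV1OfT3_one (i : KIdx 2 ℓ hd3 hL b₀ b₁) {c35 α₀ : ℝ} (hc : 0 < c35) (hα : 0 < α₀) :
    (bgT3 i).Reg335 c35 α₀ (cfgV1OfT3 (1 : GaugeField (PV 2 ℓ i.m i.K hd3 hL) 0 (Matrix.specialUnitaryGroup (Fin 2) ℂ))) ∧
      (bgT3 i).Reg336 c35 α₀ (cfgV1OfT3 (1 : GaugeField (PV 2 ℓ i.m i.K hd3 hL) 0 (Matrix.specialUnitaryGroup (Fin 2) ℂ))) := by
  rw [cfgV1OfT3_one i]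
  exact ⟨reg335_one i hc hα, reg336_one i hc hα⟩

/-- The row's hypothesis is inhabited at the same field: `U₀ ≡ 1 ∈ 𝔘_k(L³B₃ε₁)` on the member's torus for `B₃, ε₁ > 0` (`regPr_one`). [cite: Balaban1985Variational, (6) p.278] -/
theorem regPr_one_member (m : ℕ) (hm : 1 ≤ m) (n K : ℕ) {B₃ ε₁ : ℝ} (hB₃ : 0 < B₃) (hε₁ : 0 < ε₁) :
    RegPr (⟨ℓ + 1, hL, m, hm⟩ : T3Family) n K (((ℓ + 1 : ℕ) : ℝ) ^ 3 * B₃ * ε₁)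
      (1 : GaugeField (PV 2 ℓ m K hd3 hL) 0 (Matrix.specialUnitaryGroup (Fin 2) ℂ)) :=
  regPr_one (by positivity)

end Summit.QuantumFields.YangMills.Theorems.Prop7SectET3BgClass

end
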